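import Literature.Geometry.Riemannian.ShrinkerEntropyProofs
import Literature.Geometry.Riemannian.ShrinkerScalarCurvatureNonnegHolds
import Literature.Geometry.Riemannian.ShrinkerPotentialGrowthProofs
import Summits.SmoothPoincare4.SmoothPoincare4.Theorems.EntropyRungNoncompactShrinkerGapStubCompactSupportLSIMixture
import HarnessLib

/-!
# Stub `stub_shrinkerLSI_ff_of_bakryEmery` of line `collapsed-ends-usc` (crux
# `EntropyRung.NoncompactShrinkerGap`, stmt-SmoothPoincare4-10868): Carrillo–Ni's clause (ii) for
# densities of finite Fisher information, from the Bakry–Émery logarithmic Sobolev inequality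

The registered worker stub `BakryEmeryLSI → ShrinkerLSIFiniteFisher` of skeleton v8
(`Cruxes/NoncompactShrinkerGap/Lines/collapsed_ends_usc.lean`). On a complete connected gradient
shrinking Ricci soliton `(M, g, f)` of dimension `n` (`Ric + Hess f = g/2`, normalised by
`R + |∇f|² = f`, closed `g`-balls compact), for every smooth `ψ` whose density
`u = (4π)^{-n/2} e^{-ψ}` has unit mass, bounded second moment, integrable `𝒲`-integrand and finite
Fisher information `∫ |∇ψ|² u < ∞`, the Bakry–Émery inequality of the `CD(½, ∞)` space
`(M, g, Θ⁻¹ (4π)^{-n/2} e^{-f} dV)` in the form `∫ (f + log Θ − ψ) u ≤ ∫ |∇(f − ψ)|² u`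
(`Θ = (4π)^{-n/2} ∫ e^{-f}`; Carrillo–Ni 2009, Thm. 3.1) gives Carrillo–Ni's clause (ii),
`log Θ ≤ 𝒲(g, ψ, 1)` (Carrillo–Ni 2009, Thm. 1.1 (ii) and §4).

PROOF. Everything is in the tree. `R ≥ 0` on every complete connected gradient shrinker
(`shrinkerScalarCurvature_nonneg_holds`, Zhang 2009 / Chen 2009, discharged); hence `|∇f|² ≤ f`, a
minimum point `p` of `f` (`HaslhoferMuller.exists_forall_potential_le`) and the lower quadratic
growth `¼ (r − 5n)₊² ≤ f(x)` for `r ≤ d(p, x)`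
(`HaslhoferMuller.potential_lower_of_scalarCurvature_nonneg`; the regularity instances of the smooth
Levi-Civita connection come from `isLocallyContMDiff_leviCivita_holds`); hence `f` is proper
(`NoncompactShrinkerGapCompactSupportLSI.isCompact_sublevel_of_growth`). With `f` proper and
`R ≥ −0`, the tree's reduction `CarrilloNi2009_shrinkerLSI.clause_ii_of_lsi` of clause (ii) to the
LSI applies verbatim, the LSI being the Bakry–Émery antecedent at the shrinker and density at hand.
No definition and no named fact is introduced.
-/

noncomputable section

-- `Summit.SmoothPoincare4.SmoothPoincare4.…` (summit = problem) trips `dupNamespace` on every decl.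
set_option linter.dupNamespace false

open scoped Manifold ContDiff ENNReal NNReal Topology
open MeasureTheory Set Filter
open Literature.Geometry.Lorentzian Literature.Geometry.Riemannian

namespace Summit.SmoothPoincare4.SmoothPoincare4.Theorems.NoncompactShrinkerGapShrinkerLSIFiniteFisher

open Summit.SmoothPoincare4.SmoothPoincare4.Theorems.NoncompactShrinkerGapCompactSupportLSI

/-! ## Properness of the potential of a complete gradient shrinker (any dimension) -/

section Shrinker

variable {n : ℕ} {M : Type} [TopologicalSpace M] [T2Space M] [SecondCountableTopology M]
  [ChartedSpace (EuclideanSpace ℝ (Fin n)) M] [IsManifold (𝓡 n) ∞ M] [ConnectedSpace M]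
  [T3Space M] [MeasurableSpace M] [BorelSpace M]

/-- **`R ≥ 0` and the potential is proper** on a complete connected normalised gradient shrinker
of any dimension: `R ≥ 0` is Zhang 2009 / Chen 2009 (`shrinkerScalarCurvature_nonneg_holds`,
discharged in the tree); then `|∇f|² ≤ f`, a minimum point `p` of `f`
(`HaslhoferMuller.exists_forall_potential_le`), the lower growth `¼ (r − 5n)₊² ≤ f(x)` for
`r ≤ d(p, x)` (`HaslhoferMuller.potential_lower_of_scalarCurvature_nonneg`), and compact closed
balls make every sublevel set `{f ≤ R}` compact (`isCompact_sublevel_of_growth`). [folklore] -/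
theorem scalarCurvature_nonneg_and_isCompact_sublevel
    (g : PseudoRiemannianMetric (𝓡 n) ∞ (EuclideanSpace ℝ (Fin n)) (TangentSpace (𝓡 n) : M → Type _))
    [g.HasLeviCivita] (f : M → ℝ) (hg : g.IsRiemannian)
    (hc : ∀ (x : M) (r : NNReal), IsCompact {y : M | g.edist hg x y ≤ r})
    (hf : ContMDiff (𝓡 n) 𝓘(ℝ, ℝ) ∞ f)
    (hsol : ∀ (x : M) (X Y : TangentSpace (𝓡 n) x),
      g.ricci x X Y + g.hessian f x X Y = (1 / 2 : ℝ) * g.val x X Y)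
    (hnorm : ∀ x : M, g.scalarCurvature x + g.gradSq f x = f x) :
    (∀ x : M, 0 ≤ g.scalarCurvature x) ∧ ∀ R : ℝ, IsCompact {x | f x ≤ R} := by
  classical
  -- (2.6): `R ≥ 0` (Zhang 2009, discharged)
  have hS0 : ∀ x, 0 ≤ g.scalarCurvature x :=
    shrinkerScalarCurvature_nonneg_holds n M g f hg hc hf hsol hnorm
  -- the regularity instances of the smooth Levi-Civita connection
  have hk1 : ((1 : ℕ∞) : ℕ∞ω) + 1 ≤ (∞ : ℕ∞ω) := by
    rw [show ((1 : ℕ∞) : ℕ∞ω) + 1 = 2 by norm_num]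
    exact WithTop.coe_le_coe.2 le_top
  haveI : CovariantDerivative.ContMDiffCovariantDerivative g.leviCivita 1 :=
    ⟨g.isLocallyContMDiff_leviCivita_holds 1 hk1 univ isOpen_univ⟩
  haveI : CovariantDerivative.ContMDiffCovariantDerivative g.leviCivita ∞ :=
    ⟨g.isLocallyContMDiff_leviCivita_holds ⊤ (le_of_eq rfl) univ isOpen_univ⟩
  -- Haslhofer–Müller's Lemma 2.1 (lower half): a minimum point and the lower quadratic growth
  have hgrad : ∀ x, g.gradSq f x ≤ f x := fun x ↦ by linarith [hS0 x, hnorm x]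
  obtain ⟨p, hp⟩ := HaslhoferMuller.exists_forall_potential_le g hg hc hf hgrad hsol
  have hlow : ∀ (x : M) (r : NNReal), (r : ℝ≥0∞) ≤ g.edist hg p x →
      (1 / 4 : ℝ) * (max ((r : ℝ) - 5 * n) 0) ^ 2 ≤ f x := fun x r hr ↦ by
    have h := HaslhoferMuller.potential_lower_of_scalarCurvature_nonneg g hg hc hf hsol hnorm
      hS0 hp x r hr
    rwa [finrank_euclideanSpace_fin] at h
  -- properness
  exact ⟨hS0, isCompact_sublevel_of_growth hg hf.continuous hc hlow⟩

/-- **Carrillo–Ni's clause (ii) for finite-Fisher densities from a logarithmic Sobolev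
inequality at the density**, any dimension `n`: on a complete connected normalised gradient
shrinker, for a smooth compatible `ψ` whose density `u = (4π)^{-n/2} e^{-ψ}` has bounded second
moment, integrable `𝒲`-integrand and finite Fisher information, the inequality
`∫ (f + c − ψ) u ≤ ∫ |∇(f − ψ)|² u` gives `c ≤ 𝒲(g, ψ, 1)`. This is the tree's
`CarrilloNi2009_shrinkerLSI.clause_ii_of_lsi` with its two standing hypotheses — `f` proper and
`R ≥ −B` — discharged (`scalarCurvature_nonneg_and_isCompact_sublevel`, `B = 0`). [folklore] -/
theorem le_wEntropy_of_lsi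
    (g : PseudoRiemannianMetric (𝓡 n) ∞ (EuclideanSpace ℝ (Fin n)) (TangentSpace (𝓡 n) : M → Type _))
    [g.HasLeviCivita] (f : M → ℝ) (hg : g.IsRiemannian)
    (hc : ∀ (x : M) (r : NNReal), IsCompact {y : M | g.edist hg x y ≤ r})
    (hf : ContMDiff (𝓡 n) 𝓘(ℝ, ℝ) ∞ f)
    (hsol : ∀ (x : M) (X Y : TangentSpace (𝓡 n) x),
      g.ricci x X Y + g.hessian f x X Y = (1 / 2 : ℝ) * g.val x X Y)
    (hnorm : ∀ x : M, g.scalarCurvature x + g.gradSq f x = f x)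
    {ψ : M → ℝ} (hψ : ContMDiff (𝓡 n) 𝓘(ℝ, ℝ) ∞ ψ) (hψc : g.IsEntropyCompatible ψ 1)
    (h2 : ∃ o : M, Integrable (fun x ↦ (g.riemEDist o x).toReal ^ 2 * entropyDensity n ψ 1 x)
      g.riemVolume)
    (hW : Integrable (fun x ↦ ((g.scalarCurvature x + g.gradSq ψ x) + ψ x - n) *
      entropyDensity n ψ 1 x) g.riemVolume)
    (hgradu : Integrable (fun x ↦ g.gradSq ψ x * entropyDensity n ψ 1 x) g.riemVolume)
    {c : ℝ}
    (hlsi : ∫ x, (f x + c - ψ x) * entropyDensity n ψ 1 x ∂g.riemVolume ≤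
      ∫ x, g.gradSq (fun y ↦ f y - ψ y) x * entropyDensity n ψ 1 x ∂g.riemVolume) :
    c ≤ g.wEntropy g.leviCivita ψ 1 := by
  obtain ⟨hS0, hprop⟩ := scalarCurvature_nonneg_and_isCompact_sublevel g f hg hc hf hsol hnorm
  exact CarrilloNi2009_shrinkerLSI.clause_ii_of_lsi hg hf hsol hnorm hprop (B := 0)
    (fun x ↦ by rw [neg_zero]; exact hS0 x) hψ hψc h2 hW hgradu hlsi

end Shrinker

/-! ## The registered stub -/

/-- **Stub `stub_shrinkerLSI_ff_of_bakryEmery` of line `collapsed-ends-usc`**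
(`BakryEmeryLSI → ShrinkerLSIFiniteFisher`, unfolded): Carrillo–Ni 2009 Thm. 1.1 (ii) in the
bounded-second-moment form of §4 at `τ = 1` for smooth compatible densities of finite Fisher
information, `log((4π)^{-n/2} ∫ e^{-f}) ≤ 𝒲(g, ψ, 1)`, on every complete connected normalised
gradient shrinker, FROM the Bakry–Émery logarithmic Sobolev inequality of the `CD(½, ∞)` space
`(M, g, Θ⁻¹ (4π)^{-n/2} e^{-f} dV)` for such densities, `∫ (f + log Θ − ψ) u ≤ ∫ |∇(f − ψ)|² u`.
Proof: `le_wEntropy_of_lsi` (`R ≥ 0` ⇒ `f` proper ⇒ `CarrilloNi2009_shrinkerLSI.clause_ii_of_lsi`)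
with the LSI supplied by the antecedent at the shrinker and density at hand. [folklore] -/
theorem stub_shrinkerLSI_ff_of_bakryEmery : (∀ (n : ℕ) (M : Type) [TopologicalSpace M] [T2Space M] [SecondCountableTopology M] [ChartedSpace (EuclideanSpace ℝ (Fin n)) M] [IsManifold (𝓡 n) ∞ M] [ConnectedSpace M] [T3Space M] [MeasurableSpace M] [BorelSpace M] (g : PseudoRiemannianMetric (𝓡 n) ∞ (EuclideanSpace ℝ (Fin n)) (TangentSpace (𝓡 n) : M → Type _)) [g.HasLeviCivita] (f : M → ℝ) (hg : g.IsRiemannian), (∀ (x : M) (r : NNReal), IsCompact {y : M | g.edist hg x y ≤ r}) → ContMDiff (𝓡 n) 𝓘(ℝ, ℝ) ∞ f → (∀ (x : M) (X Y : TangentSpace (𝓡 n) x), g.ricci x X Y + g.hessian f x X Y = (1 / 2 : ℝ) * g.val x X Y) → (∀ x : M, g.scalarCurvature x + g.gradSq f x = f x) → ∀ ψ : M → ℝ, ContMDiff (𝓡 n) 𝓘(ℝ, ℝ) ∞ ψ → g.IsEntropyCompatible ψ 1 → (∃ o : M, Integrable (fun x ↦ (g.riemEDist o x).toReal ^ 2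 * entropyDensity n ψ 1 x) g.riemVolume) → Integrable (fun x ↦ g.gradSq ψ x * entropyDensity n ψ 1 x) g.riemVolume → ∫ x, (f x + Real.log ((4 * Real.pi) ^ (-(n : ℝ) / 2) * ∫ y, Real.exp (-f y) ∂g.riemVolume) - ψ x) * entropyDensity n ψ 1 x ∂g.riemVolume ≤ ∫ x, g.gradSq (fun y ↦ f y - ψ y) x * entropyDensity n ψ 1 x ∂g.riemVolume) → ∀ (n : ℕ) (M : Type) [TopologicalSpace M] [T2Space M] [SecondCountableTopology M] [ChartedSpace (EuclideanSpace ℝ (Fin n)) M] [IsManifold (𝓡 n) ∞ M] [ConnectedSpace M] [T3Space M] [MeasurableSpace M] [BorelSpace M] (g : PseudoRiemannianMetric (𝓡 n) ∞ (EuclideanSpace ℝ (Fin n)) (TangentSpace (𝓡 n) : M → Type _)) [g.HasLeviCivita] (f : M → ℝ) (hg : g.IsRiemannian), (∀ (x : M) (r : NNReal), IsCompact {y : M | g.edist hg x y ≤ r}) → ContMDiff (𝓡 n) 𝓘(ℝ, ℝ) ∞ f → (∀ (x : M) (X Y : TangentSpace (𝓡 n) x), g.ricci x X Y + g.hessian f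 x X Y = (1 / 2 : ℝ) * g.val x X Y) → (∀ x : M, g.scalarCurvature x + g.gradSq f x = f x) → ∀ ψ : M → ℝ, ContMDiff (𝓡 n) 𝓘(ℝ, ℝ) ∞ ψ → g.IsEntropyCompatible ψ 1 → (∃ o : M, Integrable (fun x ↦ (g.riemEDist o x).toReal ^ 2 * entropyDensity n ψ 1 x) g.riemVolume) → Integrable (fun x ↦ ((g.scalarCurvature x + g.gradSq ψ x) + ψ x - n) * entropyDensity n ψ 1 x) g.riemVolume → Integrable (fun x ↦ g.gradSq ψ x * entropyDensity n ψ 1 x) g.riemVolume → Real.log ((4 * Real.pi) ^ (-(n : ℝ) / 2) * ∫ x, Real.exp (-f x) ∂g.riemVolume) ≤ g.wEntropy g.leviCivita ψ 1 := by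
  intro hBE n M _ _ _ _ _ _ _ _ _ g _ f hg hc hf hsol hnorm ψ hψ hψc h2 hW hgradu
  exact le_wEntropy_of_lsi g f hg hc hf hsol hnorm hψ hψc h2 hW hgradu
    (hBE n M g f hg hc hf hsol hnorm ψ hψ hψc h2 hgradu)

end Summit.SmoothPoincare4.SmoothPoincare4.Theorems.NoncompactShrinkerGapShrinkerLSIFiniteFisher

end
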